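import Summits.QuantumFields.YangMills.Theorems.SwapVirialDeficitNearFlatLeaders
import Summits.QuantumFields.YangMills.Theorems.SwapVirialDeficitBlowUpGnomonicStratumBFlat
import HarnessLib

/-!
# NEAR-FLAT PROJECTION IN THE LEADER CHART: a configuration with a heavy leader is within `O(commutators + σ-residual)/‖im C_h‖` of an EXACTLY FLAT one (`chartDeficit = 0`)
# (free-hands support of ⟨stmt-QuantumFields-24197⟩ `SwapVirialDeficit.SwapGluedStiffness`; step (v-a) of the near-flat projection of LEAD g98's plan of record memo7 §C(c):
# the `SU(2)` ∕ `chartDeficit` transfer of ✓`NearFlat.exists_flatQuat_near`; the link of the right-hand sides to `√F` is ✓`chartBox_of_chartDeficit` + ✓`norm_comm_hub_le`)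

Given `q = (C, U) ∈ SU(2)⁴ × SU(2)^{Fol}` and a heavy index `h` (`im su2Quat(C h) ≠ 0`), project the leader quadruple by ✓`exists_flatQuat_near` (quaternion level), push it back to
`SU(2)` by `quatToSU2` (unit quaternions), and set every follower to `1`; ✓`chartDeficit_eq_zero_iff` certifies flatness (coaxial ⟹ commuting; `C♭₁ = C♭₀` ⟹ σ-relations):
* ★★★ `exists_flat_near_of_heavy (q) (h) (hh)`: `∃ q♭, chartDeficit L 0 1 q♭ = 0 ∧ (∀ i, q♭.2 i = 1) ∧` quaternion-level distance bounds
  `‖su2Quat(q.1 k) − su2Quat(q♭.1 k)‖ ≤ ‖[Ĉ_h, Ĉ_k]‖/‖im Ĉ_h‖` (`k ≠ 1`) and `‖Ĉ₁ − su2Quat(q♭.1 1)‖ ≤ ‖Ĉ₃Ĉ₁ − Ĉ₀Ĉ₃‖ + ‖[Ĉ₀, Ĉ₃]‖ + ‖[Ĉ_h, Ĉ₀]‖/‖im Ĉ_h‖` (`Ĉ_k = su2Quat (q.1 k)`).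
(Frobenius distances: ✓`fd_sq_eq_two_mul`; the corner/B fallbacks (v-b) and the assembly into a Hölder-1/4 `exists_flat_near` are the sequel.)

HONEST LABEL: elementary; stubs of ➎, ⟨24197⟩ ∕ ⟨24194⟩ ∕ ⟨24497⟩ OPEN; own crux ⟨22884⟩ OPEN (blocked-on ⟨19935⟩); the Yang–Mills mass gap is NOT proved; no summit is proved by a line.
THEOREMS ONLY (0 `def`, 0 `sorry`), standard axioms.  Width seat ym-line-sfw-p2-w3 g66 (cell ym-idea-1, free hands), `--supports stmt-QuantumFields-24197`.  References: [folklore].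
-/

set_option autoImplicit false

noncomputable section

open Quaternion
open scoped Quaternion
open Literature.MathematicalPhysics.QuantumFieldTheory hiding SU2
open Literature.MathematicalPhysics.QuantumLattice
open Literature.Analysis.Calculus (radialUnit radialUnit_def)
open Literature.MathematicalPhysics.QuantumFieldTheory.Balaban1983to89.T4WilsonGaugeFlatDirection (su2Quat_injective)

namespace Summit.QuantumFields.YangMills.Theorems.SwapVirialDeficit.NearFlat

open Summit.QuantumFields.YangMills.Theorems.FemtoTransferGap
open Summit.QuantumFields.YangMills.Theorems.FemtoTransferGap.TT
open Summit.QuantumFields.YangMills.Theorems.VirialFluxGap.RingDeficit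
open Summit.QuantumFields.YangMills.Theorems.SwapVirialDeficit.SwapRing
open Summit.QuantumFields.YangMills.Theorems.SwapVirialDeficit.BlowUpRing
open Summit.QuantumFields.YangMills.Theorems.SwapVirialDeficit.ZeroModeSigma (su2Quat_quatToSU2_eq_radialUnit)

variable {L : ℕ} [NeZero L]

/-- ★★★ **NEAR-FLAT PROJECTION IN THE LEADER CHART** (principal sector): see the file header. [folklore] -/
theorem exists_flat_near_of_heavy (q : (Fin 4 → SU2) × (Fol L → SU2)) (h : Fin 4) (hh : (su2Quat (q.1 h)).im ≠ 0) :
    ∃ qf : (Fin 4 → SU2) × (Fol L → SU2), chartDeficit L (fun _ => false) (fun _ => 1) qf = 0 ∧ (∀ i, qf.2 i = 1) ∧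
      (∀ k, k ≠ 1 → ‖su2Quat (q.1 k) - su2Quat (qf.1 k)‖ ≤
        ‖su2Quat (q.1 h) * su2Quat (q.1 k) - su2Quat (q.1 k) * su2Quat (q.1 h)‖ / ‖(su2Quat (q.1 h)).im‖) ∧
      ‖su2Quat (q.1 1) - su2Quat (qf.1 1)‖ ≤ ‖su2Quat (q.1 3) * su2Quat (q.1 1) - su2Quat (q.1 0) * su2Quat (q.1 3)‖ +
        ‖su2Quat (q.1 0) * su2Quat (q.1 3) - su2Quat (q.1 3) * su2Quat (q.1 0)‖ +
        ‖su2Quat (q.1 h) * su2Quat (q.1 0) - su2Quat (q.1 0) * su2Quat (q.1 h)‖ / ‖(su2Quat (q.1 h)).im‖ := by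
  set C : Fin 4 → ℍ := fun k => su2Quat (q.1 k) with hC
  have hunit : ∀ k, ‖C k‖ = 1 := fun k => norm_su2Quat (q.1 k)
  obtain ⟨Cf, hfu, hfc, hf10, hfd, hfd1⟩ := exists_flatQuat_near C hunit h hh
  have hne : ∀ k, Cf k ≠ 0 := fun k => by
    intro h0; have := hfu k; rw [h0, norm_zero] at this; exact zero_ne_one this
  -- the projected configuration
  refine ⟨(fun k => quatToSU2 (Cf k), fun _ => 1), ?_, fun _ => rfl, ?_, ?_⟩
  · -- flatness
    have hsq : ∀ k, su2Quat (quatToSU2 (Cf k)) = Cf k := fun k => by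
      rw [su2Quat_quatToSU2_eq_radialUnit (hne k), radialUnit_def, hfu k, inv_one, one_smul]
    have lift : ∀ {k l k' l' : Fin 4}, Cf k * Cf l = Cf k' * Cf l' →
        quatToSU2 (Cf k) * quatToSU2 (Cf l) = quatToSU2 (Cf k') * quatToSU2 (Cf l') := fun h =>
      su2Quat_injective (by rw [Balaban1983to89.T4HaarSU2Translate.su2Quat_mul, Balaban1983to89.T4HaarSU2Translate.su2Quat_mul, hsq, hsq, hsq, hsq]; exact h)
    rw [chartDeficit_eq_zero_iff]
    refine ⟨fun μ ν => lift (hfc _ _), fun μ => ?_, fun i => rfl⟩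
    fin_cases μ
    · show quatToSU2 (Cf (Fin.last 3)) * quatToSU2 (Cf (Fin.castSucc (Equiv.swap (0 : Fin 3) 1 0))) =
        quatToSU2 (Cf (Fin.castSucc 0)) * quatToSU2 (Cf (Fin.last 3))
      rw [Equiv.swap_apply_left]
      show quatToSU2 (Cf 3) * quatToSU2 (Cf 1) = quatToSU2 (Cf 0) * quatToSU2 (Cf 3)
      exact lift (by rw [hf10]; exact hfc 3 0)
    · show quatToSU2 (Cf (Fin.last 3)) * quatToSU2 (Cf (Fin.castSucc (Equiv.swap (0 : Fin 3) 1 1))) =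
        quatToSU2 (Cf (Fin.castSucc 1)) * quatToSU2 (Cf (Fin.last 3))
      rw [Equiv.swap_apply_right]
      show quatToSU2 (Cf 3) * quatToSU2 (Cf 0) = quatToSU2 (Cf 1) * quatToSU2 (Cf 3)
      exact lift (by rw [hf10]; exact hfc 3 0)
    · show quatToSU2 (Cf (Fin.last 3)) * quatToSU2 (Cf (Fin.castSucc (Equiv.swap (0 : Fin 3) 1 2))) =
        quatToSU2 (Cf (Fin.castSucc 2)) * quatToSU2 (Cf (Fin.last 3))
      rw [Equiv.swap_apply_of_ne_of_ne (by decide) (by decide)]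
      exact lift (hfc _ _)
  · intro k hk
    show ‖C k - su2Quat (quatToSU2 (Cf k))‖ ≤ _
    rw [su2Quat_quatToSU2_eq_radialUnit (hne k), radialUnit_def, hfu k, inv_one, one_smul]
    exact hfd k hk
  · show ‖C 1 - su2Quat (quatToSU2 (Cf 1))‖ ≤ _
    rw [su2Quat_quatToSU2_eq_radialUnit (hne 1), radialUnit_def, hfu 1, inv_one, one_smul]
    exact hfd1

end Summit.QuantumFields.YangMills.Theorems.SwapVirialDeficit.NearFlat

end
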